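import Summits.QuantumFields.YangMills.Theorems.BalabanUVNodesN15TwoSpacingGluingSopLocality
import HarnessLib

/-!
# N15 = NE2, road (c) — PROGRAMME (PC), towards (PC-D): THE TRIPLE-PRODUCT CLOSENESS KERNEL — `ABC − A₁B₁C₁ = (A − A₁)BC + A₁(B − B₁)C + A₁B₁(C − C₁)` with each factor's closeness
# weighted by `s + f·e^{−cd_Z}` at its OUTPUT, the weight carried to the output of the product (dag-n15-c g28, n15-c∕299j)

Cell `pub-ymgap`, seat `pub-ymgap-dag-n15-c` (generation g28; R134 (a), s1; HUMAN RULING D-0062).  `bears_on: R4∕N15 · K3⁸ SpineGivenEndpointR13SepCoPHV (stmt-QuantumFields-27366)`;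
filed `--kind proof --supports stmt-QuantumFields-27366 --as helper` — COUNT-NEUTRAL.  0 `def`, 0 `sorry`; ABSTRACT block-majorant algebra.  Imports n15-c∕297 `…TwoSpacingGluingSopLocality`
(`hasMaj_nfW_comp_exp`, `hasMaj_comp_nfW`; through it [B11] `hasMaj_comp_exp`).  Nothing in the tree is modified.

WHY ((PC-D), HOME PCD-DESIGN-g28.md).  The per-cube Landau LETTER is the closeness of `landauCov(U^{u_□}) = (D G′)·(Q′ᵀS⁻¹Q′)·(G′D*)` to its flat value near `□`; with the middle factor
itself a triple product, the letter is TWO applications of one abstract kernel: for `A, A₁ : F₂ → F₃`, `B, B₁ : F₁ → F₂`, `C, C₁ : F₀ → F₁` with rows `a·e^{−δd}`, `b·e^{−δd}`, `c·e^{−δd}`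
(for `A₁, B, B₁, C`… as needed) and closeness `A − A₁ ≤ (s_A + f_Ae^{−κd_Z(y)})·p_Ae^{−δd}` etc. (weights at the OUTPUT of each difference), the difference `ABC − A₁B₁C₁` has the majorant
`((s_A p_A b c + a p_B s_B c + a b p_C s_C) + (f-terms)·e^{−md_Z(y)})·κ…c_r²·e^{−rd}` — ★ `triple_sub_triple_eq`, ★★★ `hasMaj_triple_sub_triple` (297's kernels: the weight of the first
factor stays at the output, the weights of the second and third factors are moved to the output by the LIPSCHITZ minorant `d_Z`).

HONEST FRAMING ∕ LIMITS.  Abstract bookkeeping; [B9] Cor. 3.8 ∕ (3.95)–(3.96) cited for MECHANISM only.  NE2⁺ NOT PRINTED, NOT proved; N15 of record untouched; K3⁸ OPEN; counts UNMOVED.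
Restate-immune (no Theses import).
-/

noncomputable section

open scoped BigOperators
open Finset

namespace Summit.QuantumFields.YangMills.BalabanUVNodes.N15.Gluing

open Literature.MathematicalPhysics.QuantumFieldTheory.Balaban1983to89
open Literature.MathematicalPhysics.QuantumFieldTheory.Balaban1983to89.B11SectG (BlockNorm HasMaj RowSum)
open Literature.MathematicalPhysics.QuantumFieldTheory.Balaban1983to89.B6RandomWalk (Triangle254)

section Triple

variable {g : B6.Geometry} {F₀ F₁ F₂ F₃ : Type} [AddCommGroup F₀] [Module ℝ F₀] [AddCommGroup F₁] [Module ℝ F₁] [AddCommGroup F₂] [Module ℝ F₂] [AddCommGroup F₃] [Module ℝ F₃]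
  (dZ : g.Site → ℝ) {σ cr : ℝ}

omit [AddCommGroup F₀] [Module ℝ F₀] in
/-- ★ THE THREE-TERM IDENTITY `ABC − A₁B₁C₁ = (A − A₁)BC + A₁(B − B₁)C + A₁B₁(C − C₁)` (right-associated). [folklore] -/
theorem triple_sub_triple_eq {F₀ : Type} [AddCommGroup F₀] [Module ℝ F₀] (A A₁ : F₂ →ₗ[ℝ] F₃) (B B₁ : F₁ →ₗ[ℝ] F₂) (C C₁ : F₀ →ₗ[ℝ] F₁) :
    A ∘ₗ (B ∘ₗ C) - A₁ ∘ₗ (B₁ ∘ₗ C₁) = (A - A₁) ∘ₗ (B ∘ₗ C) + A₁ ∘ₗ ((B - B₁) ∘ₗ C) + A₁ ∘ₗ (B₁ ∘ₗ (C - C₁)) := by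
  simp only [LinearMap.sub_comp, LinearMap.comp_sub]
  abel

/-- ★★★ **CLOSENESS OF A TRIPLE PRODUCT FROM ITS FACTORS'**, weights `s + f·e^{−κd_Z}` at each difference's OUTPUT, `d_Z ≥ 0` a Lipschitz minorant, row sum `(σ, c_r)`, rates
`r + σ + m ≤ r₁`, `r₁ + σ + m ≤ δ`, `0 ≤ m ≤ κ`: rows `A₁ ≤ ae^{−δd}`, `B, B₁ ≤ be^{−δd}`, `C ≤ ce^{−δd}`, differences `A − A₁ ≤ (s_A + f_Ae^{−κd_Z(y)})p_Ae^{−δd}`,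
`B − B₁ ≤ (s_B + f_Be^{−κd_Z(y)})p_Be^{−δd}`, `C − C₁ ≤ (s_C + f_Ce^{−κd_Z(y)})p_Ce^{−δd}` ⟹
`ABC − A₁B₁C₁ ≤ [(s_A + f_Ae^{−md_Z(y)})·κ₂p_A(κ₁bcc_r)c_r + (s_B + f_Be^{−md_Z(y)})·κ₂a(κ₁p_Bcc_r)c_r + (s_C + f_Ce^{−md_Z(y)})·κ₂a(κ₁bp_Cc_r)c_r]·e^{−rd}`.
[cite: Balaban1985BackgroundPropagators, Cor. 3.8 p.410, (3.95)–(3.96) p.411 (mechanism)] -/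
theorem hasMaj_triple_sub_triple {b₀ : BlockNorm g F₀} {b₁ : BlockNorm g F₁} {b₂ : BlockNorm g F₂} {b₃ : BlockNorm g F₃}
    {A A₁ : F₂ →ₗ[ℝ] F₃} {B B₁ : F₁ →ₗ[ℝ] F₂} {C C₁ : F₀ →ₗ[ℝ] F₁}
    (htri : Triangle254 g) (hd : ∀ y y' : g.Site, 0 ≤ g.dist y y') (hrow : RowSum g σ cr) (hσ : 0 ≤ σ) (hcr : 0 ≤ cr) (hdZl : ∀ y z, dZ y ≤ g.dist y z + dZ z) (hdZ0 : ∀ y, 0 ≤ dZ y)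
    {a b c pA pB pC sA fA sB fB sC fC δ κ m r₁ r : ℝ} (ha : 0 ≤ a) (hb : 0 ≤ b) (hc : 0 ≤ c) (hpA : 0 ≤ pA) (hpB : 0 ≤ pB) (hpC : 0 ≤ pC)
    (hsA : 0 ≤ sA) (hfA : 0 ≤ fA) (hsB : 0 ≤ sB) (hfB : 0 ≤ fB) (hsC : 0 ≤ sC) (hfC : 0 ≤ fC) (hm : 0 ≤ m) (hmκ : m ≤ κ) (hr : 0 ≤ r) (hr₁ : r + σ + m ≤ r₁) (hr₁δ : r₁ + σ + m ≤ δ)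
    (hA₁ : HasMaj b₂ b₃ A₁ (fun y y' => a * Real.exp (-(δ * g.dist y y')))) (hB : HasMaj b₁ b₂ B (fun y y' => b * Real.exp (-(δ * g.dist y y'))))
    (hB₁ : HasMaj b₁ b₂ B₁ (fun y y' => b * Real.exp (-(δ * g.dist y y')))) (hC : HasMaj b₀ b₁ C (fun y y' => c * Real.exp (-(δ * g.dist y y'))))
    (hAA : HasMaj b₂ b₃ (A - A₁) (fun y y' => (sA + fA * Real.exp (-(κ * dZ y))) * (pA * Real.exp (-(δ * g.dist y y')))))
    (hBB : HasMaj b₁ b₂ (B - B₁) (fun y y' => (sB + fB * Real.exp (-(κ * dZ y))) * (pB * Real.exp (-(δ * g.dist y y')))))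
    (hCC : HasMaj b₀ b₁ (C - C₁) (fun y y' => (sC + fC * Real.exp (-(κ * dZ y))) * (pC * Real.exp (-(δ * g.dist y y'))))) :
    HasMaj b₀ b₃ (A ∘ₗ (B ∘ₗ C) - A₁ ∘ₗ (B₁ ∘ₗ C₁))
      (fun y y' => ((sA + fA * Real.exp (-(m * dZ y))) * (b₂.κ * pA * (b₁.κ * b * c * cr) * cr) +
          (sB + fB * Real.exp (-(m * dZ y))) * (b₂.κ * a * (b₁.κ * pB * c * cr) * cr) +
          (sC + fC * Real.exp (-(m * dZ y))) * (b₂.κ * a * (b₁.κ * b * pC * cr) * cr)) * Real.exp (-(r * g.dist y y'))) := by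
  have hκ₁ := b₁.κ_nonneg
  have hκ₂ := b₂.κ_nonneg
  have hr₁0 : 0 ≤ r₁ := by linarith
  have hwA : ∀ y, 0 ≤ sA + fA * Real.exp (-(κ * dZ y)) := fun y => by positivity
  have hwB : ∀ y, 0 ≤ sB + fB * Real.exp (-(κ * dZ y)) := fun y => by positivity
  have hwC : ∀ y, 0 ≤ sC + fC * Real.exp (-(κ * dZ y)) := fun y => by positivity
  -- TERM 1: `(A − A₁)∘(B∘C)` — weight at the output already
  have hBC : HasMaj b₀ b₂ (B ∘ₗ C) (fun y y' => b₁.κ * b * c * cr * Real.exp (-(r₁ * g.dist y y'))) :=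
    B11SectG.hasMaj_comp_exp htri hd hrow hb hc hr₁0 (by linarith) (by linarith) hB hC
  have h1 : HasMaj b₀ b₃ ((A - A₁) ∘ₗ (B ∘ₗ C)) (fun y y' => (sA + fA * Real.exp (-(κ * dZ y))) * (b₂.κ * pA * (b₁.κ * b * c * cr) * cr * Real.exp (-(r * g.dist y y')))) :=
    hasMaj_nfW_comp_exp htri hd hrow hwA hpA (by positivity) hr (by linarith) (by linarith) hAA hBC
  -- TERM 2: `A₁∘((B − B₁)∘C)` — weight at the middle point, moved out once
  have h2a : HasMaj b₀ b₂ ((B - B₁) ∘ₗ C) (fun y y' => (sB + fB * Real.exp (-(κ * dZ y))) * (b₁.κ * pB * c * cr * Real.exp (-(r₁ * g.dist y y')))) :=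
    hasMaj_nfW_comp_exp htri hd hrow hwB hpB hc hr₁0 (by linarith) (by linarith) hBB hC
  have h2 : HasMaj b₀ b₃ (A₁ ∘ₗ ((B - B₁) ∘ₗ C)) (fun y y' => (sB + fB * Real.exp (-(m * dZ y))) * (b₂.κ * a * (b₁.κ * pB * c * cr) * cr * Real.exp (-(r * g.dist y y')))) :=
    hasMaj_comp_nfW dZ htri hd hrow hdZl hdZ0 ha (by positivity) hsB hfB hm hmκ hr (by linarith) (by linarith) hA₁ h2a
  -- TERM 3: `A₁∘(B₁∘(C − C₁))` — weight at the innermost point, moved out twice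
  have h3a : HasMaj b₀ b₂ (B₁ ∘ₗ (C - C₁)) (fun y y' => (sC + fC * Real.exp (-(m * dZ y))) * (b₁.κ * b * pC * cr * Real.exp (-(r₁ * g.dist y y')))) :=
    hasMaj_comp_nfW dZ htri hd hrow hdZl hdZ0 hb hpC hsC hfC hm hmκ hr₁0 (by linarith) (by linarith) hB₁ hCC
  have h3 : HasMaj b₀ b₃ (A₁ ∘ₗ (B₁ ∘ₗ (C - C₁))) (fun y y' => (sC + fC * Real.exp (-(m * dZ y))) * (b₂.κ * a * (b₁.κ * b * pC * cr) * cr * Real.exp (-(r * g.dist y y')))) :=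
    hasMaj_comp_nfW dZ htri hd hrow hdZl hdZ0 ha (by positivity) hsC hfC hm le_rfl hr (by linarith) (by linarith) hA₁ h3a
  rw [triple_sub_triple_eq]
  refine ((h1.add h2).add h3).mono fun y y' => ?_
  have hE := Real.exp_nonneg (-(r * g.dist y y'))
  have hmono : Real.exp (-(κ * dZ y)) ≤ Real.exp (-(m * dZ y)) := Real.exp_le_exp.2 (by nlinarith [hdZ0 y, hmκ])
  have hwle : sA + fA * Real.exp (-(κ * dZ y)) ≤ sA + fA * Real.exp (-(m * dZ y)) := by nlinarith [hmono, hfA]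
  have hK1 : 0 ≤ b₂.κ * pA * (b₁.κ * b * c * cr) * cr * Real.exp (-(r * g.dist y y')) := by positivity
  have hT1 := mul_le_mul_of_nonneg_right hwle hK1
  calc (sA + fA * Real.exp (-(κ * dZ y))) * (b₂.κ * pA * (b₁.κ * b * c * cr) * cr * Real.exp (-(r * g.dist y y'))) +
        (sB + fB * Real.exp (-(m * dZ y))) * (b₂.κ * a * (b₁.κ * pB * c * cr) * cr * Real.exp (-(r * g.dist y y'))) +
        (sC + fC * Real.exp (-(m * dZ y))) * (b₂.κ * a * (b₁.κ * b * pC * cr) * cr * Real.exp (-(r * g.dist y y')))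
      ≤ (sA + fA * Real.exp (-(m * dZ y))) * (b₂.κ * pA * (b₁.κ * b * c * cr) * cr * Real.exp (-(r * g.dist y y'))) +
        (sB + fB * Real.exp (-(m * dZ y))) * (b₂.κ * a * (b₁.κ * pB * c * cr) * cr * Real.exp (-(r * g.dist y y'))) +
        (sC + fC * Real.exp (-(m * dZ y))) * (b₂.κ * a * (b₁.κ * b * pC * cr) * cr * Real.exp (-(r * g.dist y y'))) := by linarith
    _ = _ := by ring

end Triple

end Summit.QuantumFields.YangMills.BalabanUVNodes.N15.Gluing

end
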